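import Literature.AlgebraicGeometry.Resolution.IdealSheafFlatDescentStalk
import Literature.AlgebraicGeometry.Resolution.KollarEtaleNeighbourhood
import HarnessLib

/-!
# Effective descent of ideal sheaves along a flat open covering family (fpqc descent of
# closed subschemes, sheaf form)

Topic: `Literature/AlgebraicGeometry/Resolution`. Let `e_k : V_k → X` (`k ∈ κ`, finite) be
quasi-compact, FLAT morphisms with open underlying maps (e.g. étale morphisms from affine schemes
to a quasi-separated scheme), jointly surjective, and let `J_k` be quasi-coherent ideal sheaves on
the `V_k` identified on all fibre products: `pr₁^* J_k = pr₂^* J_{k'}` on `V_k ×_X V_{k'}` (a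
descent datum, including `k = k'`). Then the `J_k` DESCEND: there is an ideal sheaf `J` on `X` with
`e_k^* J = J_k` for every `k`, namely `J = ⨅_k (e_k)_♯ J_k`, where `(e)_♯ K = K.map e` is Mathlib's
"sections whose pull-back lies in `K`" ideal (`Scheme.IdealSheafData.map`, the kernel of
`𝒪_X → e_* 𝒪_{V(K)}`). Grothendieck's fpqc descent for quasi-coherent sheaves (SGA 1 VIII 1.1;
The Stacks Project, Tags 023N, 0245 for closed subschemes); the ring-level step is
`Literature.RingTheory.Flat.Ideal.eq_map_comap_of_map_includeLeft_le`, the stalk-level step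
`stalkIdeal_eq_map_comap_of_descent` / `comap_stalkIdeal_eq_of_descent`
(`IdealSheafFlatDescentStalk.lean`). This file supplies the sheaf bookkeeping:

* `mem_ideal_iff_forall_germ_mem_stalkIdeal` — membership in `J(W)` (`W` affine) is tested on
  the stalks (the openness of the locus where a germ lies in the stalk ideal is
  `exists_basicOpen_forall_germ_mem_stalkIdeal`, file `KollarEtaleNeighbourhood`);
* `mem_map_ideal_iff` — sections of `(e)_♯ K` over an affine `U`: `s ∈ ((e)_♯K)(U)` iff the germs
  of `e^* s` at all points of `e⁻¹ U` lie in the stalks of `K`;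
* `stalkMap_germ_mem_stalkIdeal_transfer`, `exists_open_forall_stalkMap_germ_mem` — the
  predicate "`e_{k,w}^*(s_x) ∈ (J_k)_w`" is independent of the point `(k, w)` over `x` and open
  in `x`; `stalkIdeal_iInf_map_eq` — the stalks of `⨅_k (e_k)_♯ J_k` are the contractions
  `e_{k,v}^{*-1}(J_k)_v`;
* `comap_iInf_map_eq_of_descent` — **effective descent: `e_k^* (⨅_{k'} (e_{k'})_♯ J_{k'}) = J_k`.**

References: [StacksProject] Tags 023N, 0245, 03OK; A. Grothendieck, SGA 1, Exp. VIII, Thm. 1.1.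
-/

noncomputable section

open CategoryTheory CategoryTheory.Limits AlgebraicGeometry TopologicalSpace

namespace Literature.AlgebraicGeometry.Resolution

universe u

/-! ## Sections of an ideal sheaf and stalks -/

section Sections

variable {X : Scheme.{u}}

/-- **Membership in `J(W)` is tested on stalks** (`W` affine): `t ∈ J(W)` iff the germ of `t` at
every point of `W` lies in the stalk `J_x` (ideals of `Γ(X, W)` are determined by their
localizations at the points, Mathlib `IsAffineOpen.ideal_le_iff`).
[cite: Hartshorne1977, Ch. II Prop. 5.4, p. 113] -/
theorem mem_ideal_iff_forall_germ_mem_stalkIdeal (J : X.IdealSheafData) (W : X.affineOpens)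
    (t : Γ(X, W)) :
    t ∈ J.ideal W ↔ ∀ (x : X) (hx : x ∈ (W : X.Opens)),
      (X.presheaf.germ W x hx).hom t ∈ stalkIdeal J x := by
  constructor
  · intro ht x hx
    exact map_germ_le_stalkIdeal J W hx (Ideal.mem_map_of_mem _ ht)
  · intro h
    have key : Ideal.span {t} ≤ J.ideal W := by
      rw [W.2.ideal_le_iff]
      intro x hx
      rw [Ideal.map_span, Set.image_singleton, Ideal.span_le, Set.singleton_subset_iff,
        SetLike.mem_coe, ← stalkIdeal_eq_map_germ J W hx]
      exact h x hx
    exact key (Ideal.subset_span rfl)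

end Sections

/-! ## Sections of the ideal `(e)_♯ K = K.map e` -/

section MapIdeal

variable {V X : Scheme.{u}} (e : V ⟶ X) [QuasiCompact e] (K : V.IdealSheafData)

/-- Restricting `ι^*` of a section to the preimage of a smaller open is `ι^*` of the restricted
section (`ι = K.subschemeι`). [folklore] -/
private theorem subschemeι_app_res {W W' : V.Opens} (h : W' ≤ W) (t : Γ(V, W)) :
    (K.subscheme.presheaf.map (homOfLE (show K.subschemeι ⁻¹ᵁ W' ≤ K.subschemeι ⁻¹ᵁ W from
      fun _ hz => h hz)).op).hom ((K.subschemeι.app W).hom t) =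
      (K.subschemeι.app W').hom ((V.presheaf.map (homOfLE h).op).hom t) := by
  have h1 : K.subschemeι.app W ≫ K.subscheme.presheaf.map (homOfLE (show K.subschemeι ⁻¹ᵁ W' ≤
      K.subschemeι ⁻¹ᵁ W from fun _ hz => h hz)).op =
      K.subschemeι.appLE W (K.subschemeι ⁻¹ᵁ W') (fun _ hz => h hz) := rfl
  have h2 : V.presheaf.map (homOfLE h).op ≫ K.subschemeι.app W' =
      K.subschemeι.appLE W (K.subschemeι ⁻¹ᵁ W') (fun _ hz => h hz) := by
    rw [Scheme.Hom.app_eq_appLE, Scheme.Hom.map_appLE]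
  have h3 := congrArg (fun φ => φ.hom t) (h1.trans h2.symm)
  simpa using h3

/-- **Sections of `(e)_♯ K` over an affine open.** For `e : V → X` quasi-compact, an ideal sheaf
`K` on `V`, an affine open `U ⊆ X` and `s ∈ Γ(X, U)`: `s` lies in `(K.map e)(U)` — the kernel of
`Γ(X, U) → Γ(V(K), (e ∘ ι)⁻¹ U)` — iff the germ of `e^* s` at every point of `e⁻¹ U` lies in the
stalk of `K` there (test on the affine opens `W' ⊆ e⁻¹ U`, where `ker ι^* = K(W')`, and use the
locality of the structure sheaf of `V(K)`). [cite: Hartshorne1977, Ch. II Prop. 5.4 and Prop. 5.9] -/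
theorem mem_map_ideal_iff (U : X.affineOpens) (s : Γ(X, U)) :
    s ∈ (K.map e).ideal U ↔ ∀ (v : V) (hv : v ∈ e ⁻¹ᵁ (U : X.Opens)),
      (V.presheaf.germ (e ⁻¹ᵁ (U : X.Opens)) v hv).hom ((e.app U).hom s) ∈ stalkIdeal K v := by
  have h1 : (K.map e).ideal U = RingHom.ker ((K.subschemeι ≫ e).app U).hom := by
    rw [Scheme.IdealSheafData.map, Scheme.Hom.ker_apply]
  rw [h1, RingHom.mem_ker, Scheme.Hom.comp_app]
  change (K.subschemeι.app (e ⁻¹ᵁ (U : X.Opens))).hom ((e.app U).hom s) = 0 ↔ _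
  set t := (e.app U).hom s with ht
  constructor
  · intro h0 v hv
    obtain ⟨W', hW', hvW', hW'le⟩ := exists_isAffineOpen_mem_and_subset hv
    have hle : W' ≤ e ⁻¹ᵁ (U : X.Opens) := hW'le
    have hres : (K.subschemeι.app W').hom ((V.presheaf.map (homOfLE hle).op).hom t) = 0 := by
      rw [← subschemeι_app_res K hle t, h0, map_zero]
    have hmem : (V.presheaf.map (homOfLE hle).op).hom t ∈ K.ideal ⟨W', hW'⟩ := by
      rw [← Scheme.IdealSheafData.ker_subschemeι_app]
      exact hres
    have hg := (mem_ideal_iff_forall_germ_mem_stalkIdeal K ⟨W', hW'⟩ _).1 hmem v hvW'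
    convert hg using 1
    exact (TopCat.Presheaf.germ_res_apply V.presheaf (homOfLE hle) v hvW' t).symm
  · intro h
    -- locality of the structure sheaf of `V(K)` for the cover by the `ι⁻¹ W'`, `W' ⊆ e⁻¹U` affine
    let ιx := {W' : V.affineOpens // (W' : V.Opens) ≤ e ⁻¹ᵁ (U : X.Opens)}
    refine K.subscheme.sheaf.eq_of_locally_eq' (fun W' : ιx => K.subschemeι ⁻¹ᵁ (W'.1 : V.Opens))
      (K.subschemeι ⁻¹ᵁ (e ⁻¹ᵁ (U : X.Opens))) (fun W' => homOfLE fun _ hz => W'.2 hz) ?_ _ _ ?_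
    · intro z hz
      have hz' : K.subschemeι.base z ∈ e ⁻¹ᵁ (U : X.Opens) := hz
      obtain ⟨W', hW', hzW', hW'le⟩ := exists_isAffineOpen_mem_and_subset hz'
      exact Opens.mem_iSup.2 ⟨⟨⟨W', hW'⟩, hW'le⟩, hzW'⟩
    · intro W'
      refine Eq.trans ?_ (map_zero _).symm
      change (K.subscheme.presheaf.map (homOfLE _).op).hom ((K.subschemeι.app _).hom t) = 0
      rw [subschemeι_app_res K W'.2 t]
      have hmem : (V.presheaf.map (homOfLE W'.2).op).hom t ∈ K.ideal W'.1 := by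
        rw [mem_ideal_iff_forall_germ_mem_stalkIdeal]
        intro v hv
        have hg := h v (W'.2 hv)
        convert hg using 1
        exact TopCat.Presheaf.germ_res_apply V.presheaf (homOfLE W'.2) v hv t
      rw [← Scheme.IdealSheafData.ker_subschemeι_app] at hmem
      exact hmem

end MapIdeal

/-! ## Effective descent -/

section Descent

variable {X : Scheme.{u}} {κ : Type*} {V : κ → Scheme.{u}} (e : ∀ k, V k ⟶ X)
  [∀ k, Flat (e k)]
  (J : ∀ k, (V k).IdealSheafData)
  (hJ : ∀ k k', (J k).comap (pullback.fst (e k) (e k')) = (J k').comap (pullback.snd (e k) (e k')))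

/-- Germs of `f^*` of a section: `(f^{*}_{U,W} s)_x = f_x^* (s_{f x})`. [folklore] -/
private theorem germ_appLE_eq {Y Z : Scheme.{u}} (f : Y ⟶ Z) (U : Z.Opens) (W : Y.Opens)
    (hle : W ≤ f ⁻¹ᵁ U) (y : Y) (hy : y ∈ W) (s : Γ(Z, U)) :
    (Y.presheaf.germ W y hy).hom (f.appLE U W hle s) =
      (f.stalkMap y).hom ((Z.presheaf.germ U (f.base y) (hle hy)).hom s) := by
  rw [Scheme.Hom.germ_stalkMap_apply, Scheme.Hom.appLE, CommRingCat.comp_apply,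
    TopCat.Presheaf.germ_res_apply]

include hJ in
/-- **Transfer between points over the same `x`**: if `e_{k₀,w₀}^*(s_x) ∈ (J k₀)_{w₀}` and
`(e k₀) w₀ = (e k) w = x`, then `e_{k,w}^*(s_x) ∈ (J k)_w` (independence of the contraction,
`comap_stalkIdeal_eq_of_descent`, and transport of germs along inseparable points).
[cite: StacksProject, Tag 023N] -/
theorem stalkMap_germ_mem_stalkIdeal_transfer {U : X.Opens} (s : Γ(X, U)) {k₀ k : κ}
    {w₀ : V k₀} {w : V k} (hw₀ : (e k₀).base w₀ ∈ U) (hw : (e k).base w ∈ U)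
    (h : (e k₀).base w₀ = (e k).base w)
    (h₀ : ((e k₀).stalkMap w₀).hom ((X.presheaf.germ U ((e k₀).base w₀) hw₀).hom s) ∈
      stalkIdeal (J k₀) w₀) :
    ((e k).stalkMap w).hom ((X.presheaf.germ U ((e k).base w) hw).hom s) ∈ stalkIdeal (J k) w := by
  have hind := comap_stalkIdeal_eq_of_descent (e k₀) (e k) (J k₀) (J k) (hJ k₀ k) w₀ w h
  have hmem : (X.presheaf.germ U ((e k₀).base w₀) hw₀).hom s ∈
      (stalkIdeal (J k₀) w₀).comap ((e k₀).stalkMap w₀).hom := h₀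
  rw [hind, Ideal.mem_comap, Ideal.mem_comap] at hmem
  have hgerm : (X.presheaf.stalkCongr (Inseparable.of_eq h)).hom.hom
      ((X.presheaf.germ U ((e k₀).base w₀) hw₀).hom s) =
      (X.presheaf.germ U ((e k).base w) hw).hom s := by
    simp only [TopCat.Presheaf.stalkCongr_hom]
    exact TopCat.Presheaf.germ_stalkSpecializes_apply X.presheaf hw₀ (Inseparable.of_eq h).ge s
  rw [hgerm] at hmem
  exact hmem

include hJ in
/-- **Openness**: if `e_{k₀,w₀}^*(s_x) ∈ (J k₀)_{w₀}` for a section `s` over an affine `U ∋ x`,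
`x = (e k₀) w₀`, then there is an open `x ∈ O ⊆ U` such that `e_{k,w}^*(s_{(e k) w}) ∈ (J k)_w` for
EVERY `k` and every `w ∈ V k` over `O` (the locus is open upstairs by
`exists_basicOpen_forall_germ_mem_stalkIdeal` of `KollarEtaleNeighbourhood.lean`, its image is open because `e k₀` is an open map,
and the predicate transfers between points over the same `x`). [cite: StacksProject, Tag 023N] -/
theorem exists_open_forall_stalkMap_germ_mem (ho : ∀ k, IsOpenMap (e k).base)
    {U : X.affineOpens} (s : Γ(X, U)) {k₀ : κ} {w₀ : V k₀} (hw₀ : (e k₀).base w₀ ∈ (U : X.Opens))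
    (h₀ : ((e k₀).stalkMap w₀).hom ((X.presheaf.germ U ((e k₀).base w₀) hw₀).hom s) ∈
      stalkIdeal (J k₀) w₀) :
    ∃ (O : X.Opens) (hOU : O ≤ (U : X.Opens)), (e k₀).base w₀ ∈ O ∧
      ∀ (k : κ) (w : V k) (hw : (e k).base w ∈ O),
        ((e k).stalkMap w).hom ((X.presheaf.germ U ((e k).base w) (hOU hw)).hom s) ∈
          stalkIdeal (J k) w := by
  -- an affine neighbourhood of `w₀` inside `(e k₀)⁻¹ U` and the pulled-back section there
  have hw₀' : w₀ ∈ (e k₀) ⁻¹ᵁ (U : X.Opens) := hw₀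
  obtain ⟨W₀, hW₀, hw₀W₀, hW₀le⟩ := exists_isAffineOpen_mem_and_subset hw₀'
  have hle : W₀ ≤ (e k₀) ⁻¹ᵁ (U : X.Opens) := hW₀le
  set t := (e k₀).appLE U W₀ hle s with ht
  have hgt : ((V k₀).presheaf.germ W₀ w₀ hw₀W₀).hom t ∈ stalkIdeal (J k₀) w₀ := by
    rw [ht, germ_appLE_eq]
    exact h₀
  obtain ⟨g, hg, hD⟩ := exists_basicOpen_forall_germ_mem_stalkIdeal (J k₀) ⟨W₀, hW₀⟩ hw₀W₀ t hgt
  -- the open image of `D(g)`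
  refine ⟨⟨(e k₀).base '' ((V k₀).basicOpen g : Set (V k₀)), ho k₀ _ ((V k₀).basicOpen g).2⟩,
    ?_, ⟨w₀, hg, rfl⟩, fun k w hw => ?_⟩
  · rintro _ ⟨w₁, hw₁, rfl⟩
    exact hle ((V k₀).basicOpen_le g hw₁)
  · obtain ⟨w₁, hw₁, hw₁w⟩ := hw
    have h₁ := hD w₁ hw₁
    rw [ht, germ_appLE_eq] at h₁
    exact stalkMap_germ_mem_stalkIdeal_transfer e J hJ s _ _ hw₁w h₁

variable [Fintype κ] [∀ k, QuasiCompact (e k)]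

/-- Stalks of a finite infimum of ideal sheaves. [folklore] -/
private theorem stalkIdeal_iInf (I : κ → X.IdealSheafData) (x : X) :
    stalkIdeal (⨅ k, I k) x = ⨅ k, stalkIdeal (I k) x := by
  rw [← Finset.inf_univ_eq_iInf, ← Finset.inf_univ_eq_iInf, stalkIdeal_finset_inf]

include hJ in
/-- **The stalks of `⨅_k (e_k)_♯ J_k` are the contractions** `e_{k₀,v}^{*-1} (J k₀)_v` (any point
`v` over `x`): `≤` from the `k₀`-th term through `mem_map_ideal_iff`; `≥` because a germ with
`e_{k₀,v}^* s_x ∈ (J k₀)_v` has `e_{k,w}^* s ∈ (J k)_w` for all `k` and all `w` over a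
neighbourhood of `x` (`exists_open_forall_stalkMap_germ_mem`), hence `s ∈ ((e_k)_♯ J_k)(U')` on an
affine `U' ∋ x` by `mem_map_ideal_iff`. [cite: StacksProject, Tag 0245] -/
theorem stalkIdeal_iInf_map_eq (ho : ∀ k, IsOpenMap (e k).base) (k₀ : κ) (v : V k₀) :
    stalkIdeal (⨅ k, (J k).map (e k)) ((e k₀).base v) =
      (stalkIdeal (J k₀) v).comap ((e k₀).stalkMap v).hom := by
  rw [stalkIdeal_iInf]
  apply le_antisymm
  · refine (iInf_le _ k₀).trans ?_
    obtain ⟨U, hU, hxU, -⟩ := exists_isAffineOpen_mem_and_subset (X := X) (x := (e k₀).base v)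
      (U := ⊤) trivial
    rw [stalkIdeal_eq_map_germ _ ⟨U, hU⟩ hxU, Ideal.map_le_iff_le_comap]
    intro s hs
    rw [Ideal.mem_comap, Ideal.mem_comap, Scheme.Hom.germ_stalkMap_apply]
    exact (mem_map_ideal_iff (e k₀) (J k₀) ⟨U, hU⟩ s).1 hs v hxU
  · refine le_iInf fun k => ?_
    intro g hg
    -- `g` is the germ of a section `s` over an affine `U ∋ x`
    obtain ⟨U₀, hxU₀, s₀, rfl⟩ := X.presheaf.exists_germ_eq g
    obtain ⟨U, hU, hxU, hUle⟩ := exists_isAffineOpen_mem_and_subset hxU₀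
    have hUle' : U ≤ U₀ := hUle
    set s := (X.presheaf.map (homOfLE hUle').op).hom s₀ with hs
    have hgs : (X.presheaf.germ U₀ _ hxU₀).hom s₀ = (X.presheaf.germ U _ hxU).hom s := by
      rw [hs, TopCat.Presheaf.germ_res_apply]
    rw [hgs] at hg ⊢
    -- the predicate at `(k₀, v)` and an open neighbourhood where it holds for all `(k, w)`
    have h₀ : ((e k₀).stalkMap v).hom ((X.presheaf.germ U _ hxU).hom s) ∈ stalkIdeal (J k₀) v := hg
    obtain ⟨O, hOU, hxO, hP⟩ :=
      exists_open_forall_stalkMap_germ_mem e J hJ ho (U := ⟨U, hU⟩) s hxU h₀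
    obtain ⟨U', hU', hxU', hU'O⟩ := exists_isAffineOpen_mem_and_subset hxO
    have hU'O' : U' ≤ O := hU'O
    have hU'U : U' ≤ U := hU'O'.trans hOU
    -- `s|U' ∈ ((e k)_♯ (J k))(U')`
    have hmem : (X.presheaf.map (homOfLE hU'U).op).hom s ∈ ((J k).map (e k)).ideal ⟨U', hU'⟩ := by
      rw [mem_map_ideal_iff]
      intro w hw
      have hw' : (e k).base w ∈ U' := hw
      have key := hP k w (hU'O' hw')
      have happ : ((e k).app U').hom ((X.presheaf.map (homOfLE hU'U).op).hom s) =
          ((e k).appLE U ((e k) ⁻¹ᵁ U') (fun _ h => hU'U h)).hom s := by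
        rw [← CommRingCat.comp_apply]
        congr 1
        rw [Scheme.Hom.app_eq_appLE, Scheme.Hom.map_appLE]
      change ((V k).presheaf.germ _ w hw).hom (((e k).app U').hom
        ((X.presheaf.map (homOfLE hU'U).op).hom s)) ∈ _
      rw [happ, germ_appLE_eq]
      exact key
    have := map_germ_le_stalkIdeal ((J k).map (e k)) ⟨U', hU'⟩ hxU' (Ideal.mem_map_of_mem _ hmem)
    rwa [TopCat.Presheaf.germ_res_apply] at this

include hJ in
/-- **Effective descent of ideal sheaves along a finite flat open covering family** (fpqc
descent for closed subschemes; The Stacks Project, Tag 0245): for quasi-compact flat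
`e_k : V_k → X` with open underlying maps and ideal sheaves `J_k` on `V_k` identified on all
fibre products (`pr₁^* J_k = pr₂^* J_{k'}` on `V_k ×_X V_{k'}`), the ideal sheaf
`J := ⨅_k (e_k)_♯ J_k` on `X` pulls back to `J_{k₀}` along every `e_{k₀}`. (Joint surjectivity is
not needed for this statement: it only concerns points in the image of `e_{k₀}`.)
[cite: StacksProject, Tag 0245] -/
theorem comap_iInf_map_eq_of_descent (ho : ∀ k, IsOpenMap (e k).base) (k₀ : κ) :
    (⨅ k, (J k).map (e k)).comap (e k₀) = J k₀ := by
  apply ext_of_forall_stalkIdeal_eq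
  intro v
  rw [stalkIdeal_comap_eq_map_stalkMap, stalkIdeal_iInf_map_eq e J hJ ho k₀ v]
  exact (stalkIdeal_eq_map_comap_of_descent (e k₀) (J k₀) (hJ k₀ k₀) v).symm

end Descent

end Literature.AlgebraicGeometry.Resolution

end
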